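import Mathlib
import Summits.ValiantsHypothesis.ValiantsHypothesis.Theorems.BarrierLeverPartitionMinorsHitByVPSimplexJoinBoxGameDimensionLaw

/-!
# Route BarrierLever — item `PartitionMinorsHitByVP` (stmt-ValiantsHypothesis-19717), line `hidden_states`:
# THE STATIC RECTANGLE LAW WITH GENERAL SIDES — an `(a+1) × (b+1)` rectangle in one piece is dead up to `r ≤ hd + a·b`

Helper file (`--supports stmt-ValiantsHypothesis-19717`; cell valiant-natproofs, rung V4, 𝒟-side door (c), line
`Cruxes/PartitionMinorsHitByVP/Lines/hidden_states.lean` v8, registered stub `stub_simplexPairLower`; prover seat val-np-p3 gen 15).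
Definition-free. Closes NO item. Sequel of p661257 (`…SimplexJoinBoxGameDimensionLaw`: the transfer principle
`not_boxWinning_of_singular[_layerCake]` and the dimension law for every `t`).

THE POINT. The `t = 1` case of the dimension law (p658056, p661257: a 2×2 rectangle in one piece is dead at `r ≤ hd + 1`) is the first
member of a family indexed by the SIDES of the rectangle. Let the position `e` contain, inside ONE piece, an injective rectangle of columns
`i : Fin (a+1) × Fin (b+1) → Fin r` each of whose slots reads either the row index or the column index only. Then the hidden point of
column `(x, y)` is ADDITIVELY SEPARABLE, `P(x,y) = A(x) + B(y)` coordinatewise, so against a row `u` of size `≤ 2` the entry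
`∏_{c∈u} P_c(x,y)` is a function of `(x, y)` of the form `α(x) + β(y)` plus, for `|u| = 2`, ONE interaction term
`A_c(x)B_d(y) + A_d(x)B_c(y)`. The vectors `κ` on the rectangle with all row sums and all column sums zero (an `a·b`-dimensional space,
parametrised by `θ : Fin a × Fin b → ℂ` through differences against the last row / column) kill every `α(x) + β(y)` (`rect_sum_eq`), and each
size-2 row imposes ONE linear condition on `θ`; so if the row family has FEWER THAN `a·b` members of size `2` (and none larger), a nonzero
`κ` in the kernel exists (`LinearMap.ker_ne_bot_of_finrank_lt`) and the simplex matrix is singular for EVERY table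
(`det_simplexMatrix_eq_zero_of_rect`). Lower families with `r` members of size `≤ 2`, fewer than `a·b` of size `2`, exist on `hd` coordinates
as soon as `r ≤ hd + a·b` and `r ≤ 1 + hd + C(hd,2)` (`exists_lower_family_pairs`). By the transfer principle: for EVERY box-game winning
predicate `W` (crude floor p647518 or layer-cake floor p656478), `¬ W hd r e` whenever `r ≤ hd + a·b`, `r ≤ 1 + hd + C(hd, 2)` and `e`
contains such a rectangle (`not_boxWinning_rect_sides[_layerCake]`). For `a = b = 1` this is the 2×2 law `r ≤ hd + 1`; for an
`(a+1) × 2` box it reads `r ≤ hd + a`, i.e. the STATIC part `n + a + 1` of val-np-p3 g14's exact game threshold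
`v*(n, (a+1, 2)) = n + (a+1) + C(a−1, 2)` (memo g14 §1; the excess `C(a−1,2)` is the dynamic drain, invisible to one-round linear algebra);
for `(3,3)` it gives `n + 5` against the game's `2n + 3`. This is the `t = 1` instance of the general static box law of memo val-np-p3 g15 §2
(`(t+1)`-slot box with sides `s_f` dead for `r < B_t(hd) + ∏(s_f − 1)`).

WHAT THIS IS NOT: a necessary condition on winning predicates; `Stmt.simplexPairLower` and item 19717 stay OPEN; nothing on crux 14610 or
VP ≠ VNP.
-/

set_option linter.dupNamespace false

namespace Summit.ValiantsHypothesis.ValiantsHypothesis.Theorems.BarrierLever.SimplexJoin.Cut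

open Finset Matrix
open Summit.ValiantsHypothesis.ValiantsHypothesis.Theorems.BarrierLever.HiddenStates

noncomputable section

/-! ## 1. Vectors with vanishing row and column sums on a rectangle -/

/-- Difference weights against the last index: `Σ_x ((x = x') − (x = last)) · G x = G x' − G last`. -/
theorem sum_diffWeight_mul {a : ℕ} (x' : Fin a) (G : Fin (a + 1) → ℂ) :
    ∑ x : Fin (a + 1), ((if x = Fin.castSucc x' then (1 : ℂ) else 0) - (if x = Fin.last a then (1 : ℂ) else 0)) * G x
      = G (Fin.castSucc x') - G (Fin.last a) := by
  simp only [sub_mul, ite_mul, one_mul, zero_mul, Finset.sum_sub_distrib, Fintype.sum_ite_eq']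

/-- **The rectangle sum identity.** For `θ : Fin a × Fin b → ℂ` let
`κ(x,y) = Σ_w θ_w ((x = w.1) − (x = last))((y = w.2) − (y = last))`. Then against any separable product `G(x)H(y)`:
`Σ_{(x,y)} κ(x,y) G(x) H(y) = Σ_w θ_w (G w.1 − G last)(H w.2 − H last)`. In particular `κ` kills every `G(x)·1` and `1·H(y)`. -/
theorem rect_sum_eq {a b : ℕ} (θ : Fin a × Fin b → ℂ) (G : Fin (a + 1) → ℂ) (H : Fin (b + 1) → ℂ) :
    ∑ z : Fin (a + 1) × Fin (b + 1),
      (∑ w : Fin a × Fin b, θ w *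
        (((if z.1 = Fin.castSucc w.1 then (1 : ℂ) else 0) - (if z.1 = Fin.last a then (1 : ℂ) else 0)) *
         ((if z.2 = Fin.castSucc w.2 then (1 : ℂ) else 0) - (if z.2 = Fin.last b then (1 : ℂ) else 0)))) * (G z.1 * H z.2)
      = ∑ w : Fin a × Fin b, θ w * ((G (Fin.castSucc w.1) - G (Fin.last a)) * (H (Fin.castSucc w.2) - H (Fin.last b))) := by
  -- expand, swap the sums, factor the inner sum over the rectangle
  have hswap : ∀ z : Fin (a + 1) × Fin (b + 1),
      (∑ w : Fin a × Fin b, θ w *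
        (((if z.1 = Fin.castSucc w.1 then (1 : ℂ) else 0) - (if z.1 = Fin.last a then (1 : ℂ) else 0)) *
         ((if z.2 = Fin.castSucc w.2 then (1 : ℂ) else 0) - (if z.2 = Fin.last b then (1 : ℂ) else 0)))) * (G z.1 * H z.2)
      = ∑ w : Fin a × Fin b, θ w *
        ((((if z.1 = Fin.castSucc w.1 then (1 : ℂ) else 0) - (if z.1 = Fin.last a then (1 : ℂ) else 0)) * G z.1) *
         (((if z.2 = Fin.castSucc w.2 then (1 : ℂ) else 0) - (if z.2 = Fin.last b then (1 : ℂ) else 0)) * H z.2)) := by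
    intro z
    rw [Finset.sum_mul]
    exact Finset.sum_congr rfl fun w _ => by ring
  simp_rw [hswap]
  rw [Finset.sum_comm]
  refine Finset.sum_congr rfl fun w _ => ?_
  rw [← Finset.mul_sum, ← sum_diffWeight_mul w.1 G, ← sum_diffWeight_mul w.2 H, Fintype.sum_mul_sum,
    Fintype.sum_prod_type]

/-! ## 2. The singular configuration: an `(a+1) × (b+1)` rectangle against fewer than `a·b` rows of size two -/

/-- **The static rectangle law (numeric form, every table).** Let the simplex column data `e` contain an injective
`(a+1) × (b+1)` rectangle `i` inside one piece, every slot reading the row index only or the column index only; let every row of `u`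
have size `≤ 2` and let fewer than `a·b` rows have size `2`. Then the simplex matrix of `(u, e)` is singular for every table. -/
theorem det_simplexMatrix_eq_zero_of_rect {m D N h r a b : ℕ}
    (u : Fin r → Finset (Fin h)) (hu2 : ∀ row, (u row).card ≤ 2)
    (hq : (Finset.univ.filter fun row => (u row).card = 2).card < a * b)
    (e : Fin r → Fin m × (Fin D → Option (Fin N))) (i : Fin (a + 1) × Fin (b + 1) → Fin r)
    (hinj : Function.Injective i)
    (hpiece : ∀ z, (e (i z)).1 = (e (i (0, 0))).1)
    (hrect : ∀ φ : Fin D, (∀ x y, (e (i (x, y))).2 φ = (e (i (x, 0))).2 φ) ∨ (∀ x y, (e (i (x, y))).2 φ = (e (i (0, y))).2 φ))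
    (tx : Fin m → Option (Fin D × Fin N) → Fin h → ℂ) :
    (Matrix.of fun row k : Fin r => ∏ c ∈ u row,
      (tx (e k).1 none c + ∑ f : Fin D, ((e k).2 f).elim 0 fun j => tx (e k).1 (some (f, j)) c)).det = 0 := by
  classical
  set M : Matrix (Fin r) (Fin r) ℂ := Matrix.of fun row k : Fin r => ∏ c ∈ u row,
      (tx (e k).1 none c + ∑ f : Fin D, ((e k).2 f).elim 0 fun j => tx (e k).1 (some (f, j)) c) with hM
  set p : Fin m := (e (i (0, 0))).1 with hp
  -- slot values and the hidden point on the rectangle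
  let g : Fin D → Fin h → Fin (a + 1) × Fin (b + 1) → ℂ := fun φ c z =>
    ((e (i z)).2 φ).elim 0 fun j => tx p (some (φ, j)) c
  let P : Fin h → Fin (a + 1) × Fin (b + 1) → ℂ := fun c z => tx p none c + ∑ φ : Fin D, g φ c z
  have hMP : ∀ row z, M row (i z) = ∏ c ∈ u row, P c z := by
    intro row z
    rw [hM, Matrix.of_apply]
    refine Finset.prod_congr rfl fun c _ => ?_
    rw [hpiece z]
  -- additive separability of every slot value, hence of the point
  have hslot : ∀ φ c (x : Fin (a + 1)) (y : Fin (b + 1)), g φ c (x, y) = g φ c (x, 0) + g φ c (0, y) - g φ c (0, 0) := by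
    intro φ c x y
    rcases hrect φ with hX | hY
    · simp only [g, hX x y, hX 0 y]; ring
    · simp only [g, hY x y, hY x 0]; ring
  let A : Fin h → Fin (a + 1) → ℂ := fun c x => P c (x, 0)
  let B : Fin h → Fin (b + 1) → ℂ := fun c y => P c (0, y) - P c (0, 0)
  have hsep : ∀ c (z : Fin (a + 1) × Fin (b + 1)), P c z = A c z.1 + B c z.2 := by
    rintro c ⟨x, y⟩
    simp only [A, B, P]
    rw [Finset.sum_congr rfl fun φ _ => hslot φ c x y, Finset.sum_sub_distrib, Finset.sum_add_distrib]
    ring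
  -- the rows of size two and their labels
  let Q := {row : Fin r // (u row).card = 2}
  have hcd : ∀ q : Q, ∃ c d : Fin h, c ≠ d ∧ u q.1 = {c, d} := fun q => Finset.card_eq_two.mp q.2
  choose cc dd hne hcd' using hcd
  -- the functional Φ_θ(G, H) and the linear conditions of the size-two rows
  let Φ : (Fin a × Fin b → ℂ) → (Fin (a + 1) → ℂ) → (Fin (b + 1) → ℂ) → ℂ := fun θ G H =>
    ∑ w : Fin a × Fin b, θ w * ((G (Fin.castSucc w.1) - G (Fin.last a)) * (H (Fin.castSucc w.2) - H (Fin.last b)))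
  have hΦadd : ∀ θ θ' G H, Φ (θ + θ') G H = Φ θ G H + Φ θ' G H := by
    intro θ θ' G H
    simp only [Φ, Pi.add_apply, add_mul, Finset.sum_add_distrib]
  have hΦsmul : ∀ (s : ℂ) θ G H, Φ (s • θ) G H = s * Φ θ G H := by
    intro s θ G H
    simp only [Φ, Pi.smul_apply, smul_eq_mul, mul_assoc, Finset.mul_sum]
  let L : (Fin a × Fin b → ℂ) →ₗ[ℂ] (Q → ℂ) :=
    { toFun := fun θ q => Φ θ (A (cc q)) (B (dd q)) + Φ θ (A (dd q)) (B (cc q))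
      map_add' := fun θ θ' => by
        funext q
        simp only [Pi.add_apply, hΦadd]
        ring
      map_smul' := fun s θ => by
        funext q
        simp only [Pi.smul_apply, smul_eq_mul, RingHom.id_apply, hΦsmul]
        ring }
  -- dimension count: a nonzero θ in the kernel
  have hlt : Module.finrank ℂ (Q → ℂ) < Module.finrank ℂ (Fin a × Fin b → ℂ) := by
    rw [Module.finrank_fintype_fun_eq_card, Module.finrank_fintype_fun_eq_card, Fintype.card_subtype,
      Fintype.card_prod, Fintype.card_fin, Fintype.card_fin]
    exact hq
  obtain ⟨θ, hθker, hθne⟩ := (Submodule.ne_bot_iff _).mp (LinearMap.ker_ne_bot_of_finrank_lt (f := L) hlt)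
  have hLθ : ∀ q : Q, Φ θ (A (cc q)) (B (dd q)) + Φ θ (A (dd q)) (B (cc q)) = 0 := by
    intro q
    have h0 : L θ = 0 := LinearMap.mem_ker.mp hθker
    exact congrFun h0 q
  -- the kernel vector on the rectangle
  let κ : Fin (a + 1) × Fin (b + 1) → ℂ := fun z => ∑ w : Fin a × Fin b, θ w *
    (((if z.1 = Fin.castSucc w.1 then (1 : ℂ) else 0) - (if z.1 = Fin.last a then (1 : ℂ) else 0)) *
     ((if z.2 = Fin.castSucc w.2 then (1 : ℂ) else 0) - (if z.2 = Fin.last b then (1 : ℂ) else 0)))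
  have hkey : ∀ (G : Fin (a + 1) → ℂ) (H : Fin (b + 1) → ℂ),
      ∑ z : Fin (a + 1) × Fin (b + 1), κ z * (G z.1 * H z.2) = Φ θ G H := fun G H => rect_sum_eq θ G H
  have hkill1 : ∀ G : Fin (a + 1) → ℂ, ∑ z : Fin (a + 1) × Fin (b + 1), κ z * G z.1 = 0 := by
    intro G
    have hG := hkey G (fun _ => 1)
    simp only [mul_one] at hG
    rw [hG]
    simp only [Φ, sub_self, mul_zero, Finset.sum_const_zero]
  have hkill2 : ∀ H : Fin (b + 1) → ℂ, ∑ z : Fin (a + 1) × Fin (b + 1), κ z * H z.2 = 0 := by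
    intro H
    have hH := hkey (fun _ => 1) H
    simp only [one_mul] at hH
    rw [hH]
    simp only [Φ, sub_self, zero_mul, mul_zero, Finset.sum_const_zero]
  -- κ is nonzero at an interior point where θ is
  have hκne : ∃ z, κ z ≠ 0 := by
    have hθ' : ∃ w, θ w ≠ 0 := by
      by_contra hno
      push Not at hno
      exact hθne (funext hno)
    obtain ⟨w₀, hw₀⟩ := hθ'
    refine ⟨(Fin.castSucc w₀.1, Fin.castSucc w₀.2), ?_⟩
    have hne1 : Fin.castSucc w₀.1 ≠ Fin.last a := (Fin.castSucc_lt_last _).ne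
    have hne2 : Fin.castSucc w₀.2 ≠ Fin.last b := (Fin.castSucc_lt_last _).ne
    have hval : κ (Fin.castSucc w₀.1, Fin.castSucc w₀.2) = θ w₀ := by
      simp only [κ, Fin.castSucc_inj, hne1, hne2, if_false, sub_zero]
      rw [Finset.sum_eq_single w₀]
      · simp
      · intro w _ hw
        by_cases h1 : w₀.1 = w.1
        · have h2 : ¬ w₀.2 = w.2 := fun h => hw (Prod.ext h1.symm h.symm)
          simp [h2]
        · simp [h1]
      · intro hmem; exact absurd (Finset.mem_univ w₀) hmem
    rw [hval]
    exact hw₀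
  -- every row is killed by κ on the rectangle
  have hrow : ∀ row, ∑ z : Fin (a + 1) × Fin (b + 1), κ z * M row (i z) = 0 := by
    intro row
    simp_rw [hMP row]
    have hc : (u row).card = 0 ∨ (u row).card = 1 ∨ (u row).card = 2 := by have := hu2 row; omega
    rcases hc with h0 | h1 | h2
    · rw [Finset.card_eq_zero] at h0
      simp_rw [h0, Finset.prod_empty]
      exact hkill1 fun _ => 1
    · obtain ⟨c, hc⟩ := Finset.card_eq_one.mp h1
      simp_rw [hc, Finset.prod_singleton, hsep c, mul_add, Finset.sum_add_distrib]
      rw [hkill1 (A c), hkill2 (B c), add_zero]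
    · let q : Q := ⟨row, h2⟩
      have huq : u row = {cc q, dd q} := hcd' q
      simp_rw [huq, Finset.prod_pair (hne q), hsep (cc q), hsep (dd q)]
      have hexp : ∀ z : Fin (a + 1) × Fin (b + 1),
          κ z * ((A (cc q) z.1 + B (cc q) z.2) * (A (dd q) z.1 + B (dd q) z.2))
            = κ z * (A (cc q) z.1 * A (dd q) z.1) + κ z * (A (cc q) z.1 * B (dd q) z.2)
              + κ z * (A (dd q) z.1 * B (cc q) z.2) + κ z * (B (cc q) z.2 * B (dd q) z.2) := by
        intro z; ring
      simp_rw [hexp, Finset.sum_add_distrib]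
      have hAA := hkill1 (fun x => A (cc q) x * A (dd q) x)
      have hBB := hkill2 (fun y => B (cc q) y * B (dd q) y)
      rw [hAA, hBB, hkey, hkey, zero_add, add_zero]
      exact hLθ q
  -- the kernel vector on all columns and the determinant
  let v : Fin r → ℂ := fun k => ∑ z ∈ Finset.univ.filter (fun z => i z = k), κ z
  have hv : v ≠ 0 := by
    obtain ⟨z₀, hz₀⟩ := hκne
    intro hv0
    have h0 := congrFun hv0 (i z₀)
    have hfil : (Finset.univ.filter fun z : Fin (a + 1) × Fin (b + 1) => i z = i z₀) = {z₀} := by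
      ext z
      simp only [Finset.mem_filter, Finset.mem_univ, true_and, Finset.mem_singleton]
      exact ⟨fun hz => hinj hz, fun hz => by rw [hz]⟩
    simp only [v, hfil, Finset.sum_singleton, Pi.zero_apply] at h0
    exact hz₀ h0
  apply Matrix.exists_mulVec_eq_zero_iff.mp
  refine ⟨v, hv, ?_⟩
  funext row
  rw [Pi.zero_apply, Matrix.mulVec, dotProduct]
  calc ∑ k, M row k * v k
      = ∑ k, ∑ z ∈ Finset.univ.filter (fun z => i z = k), κ z * M row (i z) := by
        refine Finset.sum_congr rfl fun k _ => ?_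
        rw [Finset.mul_sum]
        exact Finset.sum_congr rfl fun z hz => by rw [(Finset.mem_filter.mp hz).2, mul_comm]
    _ = ∑ z, κ z * M row (i z) := Finset.sum_fiberwise Finset.univ i (fun z => κ z * M row (i z))
    _ = 0 := hrow row

/-! ## 3. Lower families with few rows of size two -/

/-- Enumerating a finset injectively. -/
theorem exists_enum_of_card_eq {α : Type*} (L : Finset α) {r : ℕ} (hL : L.card = r) :
    ∃ u : Fin r → α, Function.Injective u ∧ (∀ i, u i ∈ L) ∧ ∀ S ∈ L, ∃ i, u i = S := by
  let φ : (L : Type _) ≃ Fin r := Finset.equivFinOfCardEq hL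
  refine ⟨fun i => (φ.symm i).1, fun i j hij => φ.symm.injective (Subtype.ext hij), fun i => (φ.symm i).2,
    fun S hS => ⟨φ ⟨S, hS⟩, by simp only [Equiv.symm_apply_apply]⟩⟩

/-- **Small lower families with a prescribed number of pairs.** For `r ≤ hd + a·b`, `r ≤ 1 + hd + C(hd, 2)` and `a·b > 0` there is an
injective LOWER family of `r` subsets of `Fin hd`, all of size `≤ 2`, fewer than `a·b` of them of size `2` (the radius-1 ball trimmed,
or the whole radius-1 ball topped up with `r − 1 − hd` pairs). -/
theorem exists_lower_family_pairs (hd a b r : ℕ) (hab : r ≤ hd + a * b) (hr : r ≤ 1 + hd + hd.choose 2) (hab0 : 0 < a * b) :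
    ∃ u : Fin r → Finset (Fin hd), Function.Injective u ∧ IsLowerSet (Set.range u) ∧ (∀ row, (u row).card ≤ 2) ∧
      (Finset.univ.filter fun row => (u row).card = 2).card < a * b := by
  classical
  by_cases hsmall : r ≤ 1 + hd
  · -- inside the radius-1 ball: no pairs at all
    have hr1 : r ≤ ∑ j ∈ Finset.range (1 + 1), hd.choose j := by
      simp [Finset.sum_range_succ]; omega
    obtain ⟨u, hu, hlow, hcard⟩ := exists_lower_family_card_le hd 1 r hr1
    refine ⟨u, hu, hlow, fun row => (hcard row).trans (by norm_num), ?_⟩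
    have h0 : (Finset.univ.filter fun row => (u row).card = 2) = ∅ := by
      ext row
      simp only [Finset.mem_filter, Finset.mem_univ, true_and, Finset.notMem_empty, iff_false]
      have := hcard row; omega
    rw [h0, Finset.card_empty]; exact hab0
  · -- the whole radius-1 ball plus `q = r − 1 − hd` pairs
    push Not at hsmall
    set B1 : Finset (Finset (Fin hd)) := Finset.univ.filter fun S => S.card ≤ 1 with hB1
    set Pairs : Finset (Finset (Fin hd)) := Finset.powersetCard 2 (Finset.univ : Finset (Fin hd)) with hPairs
    have hB1card : B1.card = 1 + hd := by
      rw [hB1, card_filter_card_le]; simp [Finset.sum_range_succ]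
    have hPcard : Pairs.card = hd.choose 2 := by
      rw [hPairs, Finset.card_powersetCard, Finset.card_univ, Fintype.card_fin]
    obtain ⟨T, hTP, hTcard⟩ := Finset.exists_subset_card_eq (s := Pairs) (n := r - (1 + hd)) (by rw [hPcard]; omega)
    have hTpair : ∀ S ∈ T, S.card = 2 := fun S hS => (Finset.mem_powersetCard.mp (hTP hS)).2
    have hdisj : Disjoint B1 T := by
      rw [Finset.disjoint_left]
      intro S hS hST
      rw [hB1, Finset.mem_filter] at hS
      have := hTpair S hST; omega
    set L : Finset (Finset (Fin hd)) := B1 ∪ T with hL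
    have hLcard : L.card = r := by
      rw [hL, Finset.card_union_of_disjoint hdisj, hB1card, hTcard]; omega
    have hLmem : ∀ S, S ∈ L ↔ S.card ≤ 1 ∨ S ∈ T := by
      intro S
      rw [hL, Finset.mem_union, hB1, Finset.mem_filter]
      simp
    have hLcard2 : ∀ S ∈ L, S.card ≤ 2 := by
      intro S hS
      rcases (hLmem S).mp hS with h | h
      · omega
      · exact (hTpair S h).le
    obtain ⟨u, hu, huL, hLu⟩ := exists_enum_of_card_eq L hLcard
    refine ⟨u, hu, ?_, fun row => hLcard2 _ (huL row), ?_⟩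
    · -- lower: subsets of size ≤ 1 are in B1; a subset of size 2 of a member of size ≤ 2 is the member itself
      intro S S' hS'S hS
      obtain ⟨i, rfl⟩ := hS
      have hmem : S' ∈ L := by
        by_cases h1 : S'.card ≤ 1
        · exact (hLmem S').mpr (Or.inl h1)
        · have hle : (u i).card ≤ S'.card := by have := hLcard2 _ (huL i); omega
          rw [Finset.eq_of_subset_of_card_le hS'S hle]
          exact huL i
      obtain ⟨j, hj⟩ := hLu S' hmem
      exact ⟨j, hj⟩
    · -- the rows of size two are exactly `T`
      have himg : (Finset.univ.filter fun row => (u row).card = 2).image u = T := by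
        ext S
        simp only [Finset.mem_image, Finset.mem_filter, Finset.mem_univ, true_and]
        constructor
        · rintro ⟨row, hrow, rfl⟩
          rcases (hLmem (u row)).mp (huL row) with h | h
          · omega
          · exact h
        · intro hS
          obtain ⟨j, hj⟩ := hLu S ((hLmem S).mpr (Or.inr hS))
          exact ⟨j, by rw [hj]; exact hTpair S hS, hj⟩
      have hcount : (Finset.univ.filter fun row => (u row).card = 2).card = T.card := by
        rw [← himg, Finset.card_image_of_injective _ hu]
      rw [hcount, hTcard]; omega

/-! ## 4. The static rectangle law for box-game winning predicates (both floors) -/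

/-- **THE STATIC RECTANGLE LAW (crude floor).** For every box-game winning predicate `W` (p647518): if `r ≤ hd + a·b`,
`r ≤ 1 + hd + C(hd, 2)`, `a·b > 0`, and the position `e` contains, inside one piece, an injective `(a+1) × (b+1)` rectangle of columns
each of whose slots reads the row index only or the column index only, then `¬ W hd r e`. (`a = b = 1`: p658056 / p661257 at `t = 1`.) -/
theorem not_boxWinning_rect_sides {m D N : ℕ}
    (W : (hd : ℕ) → (r : ℕ) → (Fin r → Fin m × (Fin D → Option (Fin N))) → Prop)
    (hwin : ∀ (hd r : ℕ) (e : Fin r → Fin m × (Fin D → Option (Fin N))), W hd r e → 2 ≤ r → 1 ≤ hd →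
      ∀ r₀ r₁ : ℕ, r₀ + r₁ = r → (r - 2) / hd + 1 ≤ r₁ → r₁ ≤ r₀ → r₀ ≤ 2 ^ (hd - 1) →
        ∃ (f : Fin m → Fin D) (side : Fin m → Option (Fin N) → Bool) (g₀ : Fin r₀ → Fin r) (g₁ : Fin r₁ → Fin r),
          Function.Injective (Sum.elim g₀ g₁) ∧
          (∀ j, side (e (g₀ j)).1 ((e (g₀ j)).2 (f (e (g₀ j)).1)) = false) ∧
          (∀ j, side (e (g₁ j)).1 ((e (g₁ j)).2 (f (e (g₁ j)).1)) = true) ∧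
          W (hd - 1) r₀ (fun j => e (g₀ j)) ∧ W (hd - 1) r₁ (fun j => e (g₁ j)))
    (a b : ℕ) (hab0 : 0 < a * b) :
    ∀ (r hd : ℕ) (e : Fin r → Fin m × (Fin D → Option (Fin N))) (i : Fin (a + 1) × Fin (b + 1) → Fin r),
      r ≤ hd + a * b → r ≤ 1 + hd + hd.choose 2 → Function.Injective i →
      (∀ z, (e (i z)).1 = (e (i (0, 0))).1) →
      (∀ φ : Fin D, (∀ x y, (e (i (x, y))).2 φ = (e (i (x, 0))).2 φ) ∨ (∀ x y, (e (i (x, y))).2 φ = (e (i (0, y))).2 φ)) →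
      ¬ W hd r e := by
  intro r hd e i hr hr2 hinj hpiece hrect
  obtain ⟨u, hu, hlow, hu2, hq⟩ := exists_lower_family_pairs hd a b r hr hr2 hab0
  exact not_boxWinning_of_singular W hwin hd r e u hu hlow
    (fun tx => det_simplexMatrix_eq_zero_of_rect u hu2 hq e i hinj hpiece hrect tx)

/-- **THE STATIC RECTANGLE LAW (layer-cake floor).** As `not_boxWinning_rect_sides`, for the sharp-floor box game of p656478. -/
theorem not_boxWinning_rect_sides_layerCake {m D N : ℕ}
    (W : (hd : ℕ) → (r : ℕ) → (Fin r → Fin m × (Fin D → Option (Fin N))) → Prop)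
    (hwin : ∀ (hd r : ℕ) (e : Fin r → Fin m × (Fin D → Option (Fin N))), W hd r e → 2 ≤ r → 1 ≤ hd →
      ∀ r₀ r₁ : ℕ, r₀ + r₁ = r →
        (∑ d ∈ Finset.range hd, (r - ∑ j ∈ Finset.range (d + 1), hd.choose j) + hd - 1) / hd ≤ r₁ → r₁ ≤ r₀ →
        r₀ ≤ 2 ^ (hd - 1) →
        ∃ (f : Fin m → Fin D) (side : Fin m → Option (Fin N) → Bool) (g₀ : Fin r₀ → Fin r) (g₁ : Fin r₁ → Fin r),
          Function.Injective (Sum.elim g₀ g₁) ∧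
          (∀ j, side (e (g₀ j)).1 ((e (g₀ j)).2 (f (e (g₀ j)).1)) = false) ∧
          (∀ j, side (e (g₁ j)).1 ((e (g₁ j)).2 (f (e (g₁ j)).1)) = true) ∧
          W (hd - 1) r₀ (fun j => e (g₀ j)) ∧ W (hd - 1) r₁ (fun j => e (g₁ j)))
    (a b : ℕ) (hab0 : 0 < a * b) :
    ∀ (r hd : ℕ) (e : Fin r → Fin m × (Fin D → Option (Fin N))) (i : Fin (a + 1) × Fin (b + 1) → Fin r),
      r ≤ hd + a * b → r ≤ 1 + hd + hd.choose 2 → Function.Injective i →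
      (∀ z, (e (i z)).1 = (e (i (0, 0))).1) →
      (∀ φ : Fin D, (∀ x y, (e (i (x, y))).2 φ = (e (i (x, 0))).2 φ) ∨ (∀ x y, (e (i (x, y))).2 φ = (e (i (0, y))).2 φ)) →
      ¬ W hd r e := by
  intro r hd e i hr hr2 hinj hpiece hrect
  obtain ⟨u, hu, hlow, hu2, hq⟩ := exists_lower_family_pairs hd a b r hr hr2 hab0
  exact not_boxWinning_of_singular_layerCake W hwin hd r e u hu hlow
    (fun tx => det_simplexMatrix_eq_zero_of_rect u hu2 hq e i hinj hpiece hrect tx)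

end

end Summit.ValiantsHypothesis.ValiantsHypothesis.Theorems.BarrierLever.SimplexJoin.Cut
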